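import Literature.AlgebraicGeometry.Hu2025.Statements.S04ModelV.R103cClaims
import Literature.AlgebraicGeometry.Hu2025.Proofs.S04ModelV.Lem45
import HarnessLib

/-!
# Hu 2025 §4.2.1, the [OPT] items of row 103 AS TYPED GENERICALLY — Lem. 4.8 / 4.9 / Cor. 4.10 ‹chunk 4.7 / 4.8 / 4.9›
# (`Lem4_8`, `Lem4_9` in file b, `Cor4_10` in file c): all three universal closures FAIL at junk instances of the generic
# index data (file `Proofs/S04ModelV/OptLemmasGeneric.lean`; typer of record res-type-042)

**HONEST FRAMING (D-0012/D-0089).** Kernel facts about OUR GENERIC renderings in `R103bDescendants.lean` / `R103cClaims.lean` (the chart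
monomials `mono : T → (σ →₀ ℕ)`, ranks `rk`, leading terms `head` arbitrary). They are NOT claims about the preprint:
Hu's platform constrains the chart monomials of the terms of one primary relation (pairwise distinct quadratic monomials;
«`x_(123,abc)` is the unique ϱ-variable whose `φ`-image is divisible by `x_abc`», chunk p0022 l.92–93), and both printed
proofs use exactly that. The three theorems tell the lanes' vacuity column and the leads that `Lem4_8` / `Lem4_9` / `Cor4_10`
become theorems only under platform hypotheses (instance level, rows 101/102/105), and say which junk data break them. The
preprint [Hu2025] stays «under review»; nothing of it is asserted; AI proof is weaker than expert review.

* §1 `not_Lem4_9`: `σ = Fin 3` (`y,z,w`), `T = Fin 4` (blocks `{0,1}`, `{2,3}`), `x̄ = (y, w, yz, z)`, `m = x₀x₂`, `m′ = x₀·y·x₃`: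
  hypothesis `x₀ ∣ m`, `x̄₀ ∣ m′` holds, `m − m′ ∈ ker^{mh}`, yet no ℘-binomial reduces it.
* §2 `not_Lem4_8`: `σ = Fin 2` (`y,z`), `T = Fin 4`, `x̄ = (y, y, z, z)` (two terms of one block with the same chart
  monomial), `rk ≡ 1`, `head = (0 ↦ x₀, 1 ↦ x₂)`, `m = x₀x₂`, `m′ = x₁x₃`: `x₀ ∣ m` but `x̄₀ = y ∤ m′`.
* §3 `not_Cor4_10`: same data as §2; `m − m′` is moreover ℘-irreducible, yet `x̄_(head 0) = y ∣ φ(m) = yz`.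
-/

noncomputable section

namespace Literature.AlgebraicGeometry.Hu2025.Statements.S04ModelV

open MvPolynomial

/-! ## §1 Lem. 4.9 ‹chunk Lem. 4.8› AS TYPED GENERICALLY (`Lem4_9`): refuted at a junk instance of the index data

Data: `k = ℤ`; ϖ-variables `y = 0, z = 1, w = 2` (`σ = Fin 3`); blocks `𝔗 = Fin 2`; terms `T = Fin 4` with `t = 0`,
`t₂ = 1` in block `0` and `s = 2`, `s′ = 3` in block `1`; chart monomials `x̄_t = y`, `x̄_{t₂} = w`, `x̄_s = y z`,
`x̄_{s′} = z`; `Φ = univ`. Binomial `m − m′`, `m = x_t x_s`, `m′ = x_t · y · x_{s′}`: nonzero, multi-homogeneous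
(bidegree `(1,1)`), `φ(m) = y·yz = y·y·z = φ(m′)`; the hypothesis of Lem. 4.9 holds for `x_(u,v) := x_t` (`x_t ∣ m`,
`x̄_t = y ∣ m′`), yet `m − m′` is NOT ℘-reducible (Def. 4.7): the ℘-binomials are those of the pairs `{t,t₂}`, `{s,s′}`
and none of the four divisibility patterns holds. A countermodel to the GENERIC typed statement (arbitrary `mono`),
NOT a claim about the preprint's platform, where the chart monomials of the terms of one relation are constrained
(pairwise distinct quadratic monomials in the basic/leading variables): it tells the lanes and the leads that `Lem4_9`
(an [OPT] item, read by no joint) needs platform hypotheses to become a theorem. -/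

/-- **`Lem4_9` as typed generically is not a theorem: its universal closure fails** (junk instance above).
[cite: Hu2025, §4.2.1 Lem. 4.9 ‹chunk Lem. 4.8›, chunk p0022 l.112–134, pp. 48–49 (unrefereed preprint arXiv:2507.21400v1 under adjudication, D-0012/D-0089 — kernel fact about OUR generic typed rendering of row 103; nothing of the source asserted)] -/
theorem not_Lem4_9 :
    ¬ ∀ (σ T 𝔗 : Type) [DecidableEq 𝔗] (rel : T → 𝔗) (mono : T → (σ →₀ ℕ)) (Φ : Set 𝔗),
        Lem4_9 (k := ℤ) (σ := σ) rel mono Φ := by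
  intro h
  classical
  -- the junk instance
  let rel : Fin 4 → Fin 2 := fun t => if t.val < 2 then 0 else 1
  let mono : Fin 4 → (Fin 3 →₀ ℕ) := fun t =>
    if t.val = 0 then Finsupp.single 0 1 else if t.val = 1 then Finsupp.single 2 1
    else if t.val = 2 then Finsupp.single 0 1 + Finsupp.single 1 1 else Finsupp.single 1 1
  let a : Fin 3 ⊕ Fin 4 →₀ ℕ := Finsupp.single (Sum.inr 0) 1 + Finsupp.single (Sum.inr 2) 1
  let a' : Fin 3 ⊕ Fin 4 →₀ ℕ :=
    Finsupp.single (Sum.inr 0) 1 + (Finsupp.single (Sum.inl 0) 1 + Finsupp.single (Sum.inr 3) 1)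
  have hL := h (Fin 3) (Fin 4) (Fin 2) rel mono Set.univ a a' 0
  -- evaluations of the exponents
  have ha : ∀ i, a i = (Finsupp.single (Sum.inr (0 : Fin 4)) 1 : Fin 3 ⊕ Fin 4 →₀ ℕ) i +
      (Finsupp.single (Sum.inr (2 : Fin 4)) 1 : Fin 3 ⊕ Fin 4 →₀ ℕ) i := fun i => Finsupp.add_apply _ _ _
  have ha' : ∀ i, a' i = (Finsupp.single (Sum.inr (0 : Fin 4)) 1 : Fin 3 ⊕ Fin 4 →₀ ℕ) i +
      ((Finsupp.single (Sum.inl (0 : Fin 3)) 1 : Fin 3 ⊕ Fin 4 →₀ ℕ) i +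
        (Finsupp.single (Sum.inr (3 : Fin 4)) 1 : Fin 3 ⊕ Fin 4 →₀ ℕ) i) := by
    intro i; simp only [a', Finsupp.add_apply]
  -- (1) the binomial is nonzero
  have hne : (monomial a (1 : ℤ) - monomial a' 1 : ModelRing (Fin 3) (Fin 4) ℤ) ≠ 0 := by
    intro h0
    have h1 := congr_arg (coeff a) (sub_eq_zero.mp h0)
    have haa : a' ≠ a := by
      intro e; have := DFunLike.congr_fun e (Sum.inr 2); rw [ha, ha'] at this; simp at this
    rw [coeff_monomial, coeff_monomial, if_pos rfl, if_neg haa] at h1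
    exact one_ne_zero h1
  -- (2) it lies in ker^{mh}
  have hmono0 : mono 0 = Finsupp.single 0 1 := by simp [mono]
  have hmono2 : mono 2 = Finsupp.single 0 1 + Finsupp.single 1 1 := by simp [mono]
  have hmono3 : mono 3 = Finsupp.single 1 1 := by simp [mono]
  have hm : (monomial a (1 : ℤ) : ModelRing (Fin 3) (Fin 4) ℤ) =
      rhoVar (k := ℤ) (σ := Fin 3) (0 : Fin 4) * rhoVar (k := ℤ) (σ := Fin 3) (2 : Fin 4) := by
    unfold rhoVar; rw [X, X, monomial_mul, one_mul]
  have hm' : (monomial a' (1 : ℤ) : ModelRing (Fin 3) (Fin 4) ℤ) =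
      rhoVar (k := ℤ) (σ := Fin 3) (0 : Fin 4) *
        (toModel (T := Fin 4) (X (0 : Fin 3) : R0 (Fin 3) ℤ) * rhoVar (k := ℤ) (σ := Fin 3) (3 : Fin 4)) := by
    unfold rhoVar toModel; rw [rename_X, X, X, X, monomial_mul, monomial_mul, one_mul, one_mul]
  have hφ : varphi (k := ℤ) mono (monomial a (1 : ℤ) - monomial a' 1 : ModelRing (Fin 3) (Fin 4) ℤ) = 0 := by
    rw [map_sub, hm, hm', map_mul, map_mul, map_mul, varphi_rhoVar, varphi_rhoVar, varphi_rhoVar, varphi_toModel,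
      sub_eq_zero]
    unfold img
    rw [hmono0, hmono2, hmono3, X, monomial_mul, monomial_mul, monomial_mul]
    all_goals simp only [mul_one]
  have hw : ∀ G : Fin 2, Finsupp.weight (blockWeight rel G) a = Finsupp.weight (blockWeight rel G) a' := by
    intro G
    simp only [a, a', map_add, Finsupp.weight_single, blockWeight, rel]
    fin_cases G <;> simp
  have hmem : (monomial a (1 : ℤ) - monomial a' 1 : ModelRing (Fin 3) (Fin 4) ℤ) ∈
      kerMH (k := ℤ) rel mono Set.univ := by
    refine ⟨?_, ?_, hφ⟩
    · rw [RSub_univ]; exact Algebra.mem_top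
    · intro G
      refine ⟨Finsupp.weight (blockWeight rel G) a, ?_⟩
      rw [← mem_weightedHomogeneousSubmodule]
      apply Submodule.sub_mem <;> rw [mem_weightedHomogeneousSubmodule] <;>
        apply isWeightedHomogeneous_monomial
      · rfl
      · exact (hw G).symm
  -- (3) the divisibility hypothesis for `x_(u,v) := x_t`, `t = 0`
  have hmonoR0 : monoR mono (0 : Fin 4) = Finsupp.single (Sum.inl (0 : Fin 3) : Fin 3 ⊕ Fin 4) 1 := by
    unfold monoR; rw [hmono0, Finsupp.mapDomain_single]
  have hdiv : (Finsupp.single (Sum.inr (0 : Fin 4)) 1 ≤ a ∧ monoR mono 0 ≤ a') ∨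
      (Finsupp.single (Sum.inr (0 : Fin 4)) 1 ≤ a' ∧ monoR mono 0 ≤ a) := by
    left
    constructor
    · exact Finsupp.le_def.mpr fun i => by rw [ha]; omega
    · rw [hmonoR0]
      exact Finsupp.le_def.mpr fun i => by rw [ha']; omega
  obtain ⟨⟨t1, t1', hrel, hne', -, -, hcases⟩, -⟩ := hL hne hmem hdiv
  -- (4) no ℘-binomial reduces it: the candidate pairs are forced to (t1, t1') ∈ {0,2} × {0,3} and all four die
  have hmonoR : ∀ u : Fin 4, ∀ j : Fin 4, monoR mono u (Sum.inr j : Fin 3 ⊕ Fin 4) = 0 :=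
    fun u j => Finsupp.mapDomain_notin_range _ _ (by rintro ⟨s, hs⟩; cases hs)
  have hmonoR2 : monoR mono (2 : Fin 4) (Sum.inl (1 : Fin 3) : Fin 3 ⊕ Fin 4) = 1 := by
    unfold monoR; rw [hmono2, Finsupp.mapDomain_add, Finsupp.mapDomain_single, Finsupp.mapDomain_single]; simp
  have hmonoR3 : monoR mono (3 : Fin 4) (Sum.inl (1 : Fin 3) : Fin 3 ⊕ Fin 4) = 1 := by
    unfold monoR; rw [hmono3, Finsupp.mapDomain_single]; simp
  have hrel' : ∀ u : Fin 4, rel u = if u.val < 2 then 0 else 1 := fun u => rfl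
  have hA : ∀ j : Fin 4, a (Sum.inr j) ≠ 0 → j = 0 ∨ j = 2 := by
    intro j; rw [ha]; fin_cases j <;> simp
  have hA' : ∀ j : Fin 4, a' (Sum.inr j) ≠ 0 → j = 0 ∨ j = 3 := by
    intro j; rw [ha']; fin_cases j <;> simp
  have haL : a (Sum.inl 1) = 0 := by rw [ha]; simp
  have ha'L : a' (Sum.inl 1) = 0 := by rw [ha']; simp
  rcases hcases with ⟨h1, h2⟩ | ⟨h1, h2⟩
  · have e1 := Finsupp.le_def.mp h1 (Sum.inr t1)
    rw [Finsupp.add_apply, hmonoR, zero_add, Finsupp.single_eq_same] at e1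
    have e2 := Finsupp.le_def.mp h2 (Sum.inr t1')
    rw [Finsupp.single_eq_same] at e2
    rcases hA t1 (by omega) with rfl | rfl <;> rcases hA' t1' (by omega) with rfl | rfl
    · exact hne' rfl
    · rw [hrel', hrel'] at hrel; exact absurd hrel (by decide)
    · rw [hrel', hrel'] at hrel; exact absurd hrel (by decide)
    · have e3 := Finsupp.le_def.mp h1 (Sum.inl 1)
      rw [Finsupp.add_apply, hmonoR3, haL] at e3
      simp at e3
  · have e1 := Finsupp.le_def.mp h1 (Sum.inr t1)
    rw [Finsupp.single_eq_same] at e1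
    have e2 := Finsupp.le_def.mp h2 (Sum.inr t1')
    rw [Finsupp.add_apply, hmonoR, zero_add, Finsupp.single_eq_same] at e2
    rcases hA t1 (by omega) with rfl | rfl <;> rcases hA' t1' (by omega) with rfl | rfl
    · exact hne' rfl
    · rw [hrel', hrel'] at hrel; exact absurd hrel (by decide)
    · rw [hrel', hrel'] at hrel; exact absurd hrel (by decide)
    · have e3 := Finsupp.le_def.mp h2 (Sum.inl 1)
      rw [Finsupp.add_apply, hmonoR2, ha'L] at e3
      simp at e3

/-! ## §2 Lem. 4.8 ‹chunk Lem. 4.7› AS TYPED GENERICALLY (`Lem4_8`): refuted at a junk instance of the index data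

Data: `k = ℤ`; ϖ-variables `y = 0, z = 1` (`σ = Fin 2`); blocks `𝔗 = Fin 2`; terms `T = Fin 4`, `t = 0, t₂ = 1` in block `0`,
`s = 2, s′ = 3` in block `1`; chart monomials `x̄_t = x̄_{t₂} = y`, `x̄_s = x̄_{s′} = z` (two terms of one block with the SAME
chart monomial — excluded on the platform, allowed by the generic carrier); every relation «of rank one» (`rk ≡ 1`),
`head 0 = t`, `head 1 = s`; `Φ = univ`. Binomial `m − m′`, `m = x_t x_s`, `m′ = x_{t₂} x_{s′}`: nonzero, no common factor,
bidegree `(1,1)`, `φ(m) = yz = φ(m′)`; `x_t = x_(head 0) ∣ m` but `x̄_t = y ∤ m′` — the first implication of `Lem4_8` fails.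
A fact about the GENERIC rendering (arbitrary `mono`, `rk`, `head`), NOT about the platform, where «`x_(123,abc)` is
the unique ϱ-variable whose `φ`-image is divisible by `x_abc`» (chunk p0022 l.92–93) holds by the shape of the primary
relations; it tells the lanes that `Lem4_8` ([OPT], read by no joint) needs those platform hypotheses. -/

/-- **`Lem4_8` as typed generically is not a theorem: its universal closure fails** (junk instance above).
[cite: Hu2025, §4.2.1 Lem. 4.8 ‹chunk Lem. 4.7›, chunk p0022 l.74–106, p.48 L013–L032 (unrefereed preprint arXiv:2507.21400v1 under adjudication, D-0012/D-0089 — kernel fact about OUR generic typed rendering of row 103; nothing of the source asserted)] -/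
theorem not_Lem4_8 :
    ¬ ∀ (σ T 𝔗 : Type) [DecidableEq 𝔗] (rel : T → 𝔗) (mono : T → (σ →₀ ℕ)) (rk : 𝔗 → ℕ) (head : 𝔗 → T)
        (Φ : Set 𝔗), Lem4_8 (k := ℤ) (σ := σ) rel mono rk head Φ := by
  intro h
  classical
  let rel : Fin 4 → Fin 2 := fun t => if t.val < 2 then 0 else 1
  let mono : Fin 4 → (Fin 2 →₀ ℕ) := fun t => if t.val < 2 then Finsupp.single 0 1 else Finsupp.single 1 1
  let rk : Fin 2 → ℕ := fun _ => 1
  let head : Fin 2 → Fin 4 := fun F => if F = 0 then 0 else 2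
  let a : Fin 2 ⊕ Fin 4 →₀ ℕ := Finsupp.single (Sum.inr 0) 1 + Finsupp.single (Sum.inr 2) 1
  let a' : Fin 2 ⊕ Fin 4 →₀ ℕ := Finsupp.single (Sum.inr 1) 1 + Finsupp.single (Sum.inr 3) 1
  have hL := h (Fin 2) (Fin 4) (Fin 2) rel mono rk head Set.univ 0 a a' rfl
  have ha : ∀ i, a i = (Finsupp.single (Sum.inr (0 : Fin 4)) 1 : Fin 2 ⊕ Fin 4 →₀ ℕ) i +
      (Finsupp.single (Sum.inr (2 : Fin 4)) 1 : Fin 2 ⊕ Fin 4 →₀ ℕ) i := fun i => Finsupp.add_apply _ _ _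
  have ha' : ∀ i, a' i = (Finsupp.single (Sum.inr (1 : Fin 4)) 1 : Fin 2 ⊕ Fin 4 →₀ ℕ) i +
      (Finsupp.single (Sum.inr (3 : Fin 4)) 1 : Fin 2 ⊕ Fin 4 →₀ ℕ) i := fun i => Finsupp.add_apply _ _ _
  -- (1) nonzero
  have hne : (monomial a (1 : ℤ) - monomial a' 1 : ModelRing (Fin 2) (Fin 4) ℤ) ≠ 0 := by
    intro h0
    have h1 := congr_arg (coeff a) (sub_eq_zero.mp h0)
    have haa : a' ≠ a := by
      intro e; have := DFunLike.congr_fun e (Sum.inr 0); rw [ha, ha'] at this; simp at this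
    rw [coeff_monomial, coeff_monomial, if_pos rfl, if_neg haa] at h1
    exact one_ne_zero h1
  -- (2) in ker^{mh}
  have hmono : ∀ u : Fin 4, mono u = if u.val < 2 then Finsupp.single 0 1 else Finsupp.single 1 1 := fun u => rfl
  have hm : (monomial a (1 : ℤ) : ModelRing (Fin 2) (Fin 4) ℤ) =
      rhoVar (k := ℤ) (σ := Fin 2) (0 : Fin 4) * rhoVar (k := ℤ) (σ := Fin 2) (2 : Fin 4) := by
    unfold rhoVar; rw [X, X, monomial_mul, one_mul]
  have hm' : (monomial a' (1 : ℤ) : ModelRing (Fin 2) (Fin 4) ℤ) =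
      rhoVar (k := ℤ) (σ := Fin 2) (1 : Fin 4) * rhoVar (k := ℤ) (σ := Fin 2) (3 : Fin 4) := by
    unfold rhoVar; rw [X, X, monomial_mul, one_mul]
  have hφ : varphi (k := ℤ) mono (monomial a (1 : ℤ) - monomial a' 1 : ModelRing (Fin 2) (Fin 4) ℤ) = 0 := by
    rw [map_sub, hm, hm', map_mul, map_mul, varphi_rhoVar, varphi_rhoVar, varphi_rhoVar, varphi_rhoVar, sub_eq_zero]
    unfold img
    rw [hmono 0, hmono 1, hmono 2, hmono 3]
    simp
  have hw : ∀ G : Fin 2, Finsupp.weight (blockWeight rel G) a = Finsupp.weight (blockWeight rel G) a' := by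
    intro G
    simp only [a, a', map_add, Finsupp.weight_single, blockWeight, rel]
    fin_cases G <;> simp
  have hmem : (monomial a (1 : ℤ) - monomial a' 1 : ModelRing (Fin 2) (Fin 4) ℤ) ∈
      kerMH (k := ℤ) rel mono Set.univ := by
    refine ⟨?_, ?_, hφ⟩
    · rw [RSub_univ]; exact Algebra.mem_top
    · intro G
      refine ⟨Finsupp.weight (blockWeight rel G) a, ?_⟩
      rw [← mem_weightedHomogeneousSubmodule]
      apply Submodule.sub_mem <;> rw [mem_weightedHomogeneousSubmodule] <;>
        apply isWeightedHomogeneous_monomial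
      · rfl
      · exact (hw G).symm
  -- (3) no common factor
  have hncf : HasNoCommonFactor (σ := Fin 2) (T := Fin 4) a a' := by
    intro i
    rw [ha, ha']
    rcases i with i | j
    · left; simp
    · fin_cases j <;> simp
  -- (4) `x_t ∣ m` but `x̄_t = y ∤ m′`
  have hhead : head 0 = 0 := rfl
  obtain ⟨⟨h1, -⟩, -⟩ := hL hne hmem hncf
  have hxt : Finsupp.single (Sum.inr (head 0)) 1 ≤ a := by
    rw [hhead]; exact Finsupp.le_def.mpr fun i => by rw [ha]; omega
  have hy := Finsupp.le_def.mp (h1 hxt) (Sum.inl 0)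
  rw [hhead, ha'] at hy
  unfold monoR at hy
  rw [hmono 0, if_pos (by decide), Finsupp.mapDomain_single] at hy
  simp at hy


/-! ## §3 Cor. 4.10 ‹chunk Cor. 4.9› AS TYPED GENERICALLY (`Cor4_10`, file c): refuted at the junk instance of §2

Same data as §2 (`x̄ = (y, y, z, z)`, `rk ≡ 1`, `head = (0 ↦ x₀, 1 ↦ x₂)`, `m = x₀x₂`, `m′ = x₁x₃`): `m − m′` is nonzero, in
`ker^{mh}`, without common factor AND ℘-irreducible (none of the four divisibility patterns of Def. 4.7 holds for the two
℘-binomials `x̄₁x₀ − x̄₀x₁`, `x̄₃x₂ − x̄₂x₃`), yet `φ(m) = yz` IS divisible by the «rank-1 variable» `x̄_(head 0) = y`. A fact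
about the GENERIC rendering only (on the platform `x_abc` divides the `φ`-image of no other ϱ-variable). -/

/-- **`Cor4_10` as typed generically is not a theorem: its universal closure fails** (junk instance of §2).
[cite: Hu2025, §4.2.1 Cor. 4.10 ‹chunk Cor. 4.9›, chunk p0022 l.136–149, p.49 L012–L017 (unrefereed preprint arXiv:2507.21400v1 under adjudication, D-0012/D-0089 — kernel fact about OUR generic typed rendering of row 103; nothing of the source asserted)] -/
theorem not_Cor4_10 :
    ¬ ∀ (σ T 𝔗 : Type) [DecidableEq 𝔗] (rel : T → 𝔗) (mono : T → (σ →₀ ℕ)) (rk : 𝔗 → ℕ) (head : 𝔗 → T)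
        (Φ : Set 𝔗), Cor4_10 (k := ℤ) (σ := σ) rel mono rk head Φ := by
  intro h
  classical
  let rel : Fin 4 → Fin 2 := fun t => if t.val < 2 then 0 else 1
  let mono : Fin 4 → (Fin 2 →₀ ℕ) := fun t => if t.val < 2 then Finsupp.single 0 1 else Finsupp.single 1 1
  let rk : Fin 2 → ℕ := fun _ => 1
  let head : Fin 2 → Fin 4 := fun F => if F = 0 then 0 else 2
  let a : Fin 2 ⊕ Fin 4 →₀ ℕ := Finsupp.single (Sum.inr 0) 1 + Finsupp.single (Sum.inr 2) 1
  let a' : Fin 2 ⊕ Fin 4 →₀ ℕ := Finsupp.single (Sum.inr 1) 1 + Finsupp.single (Sum.inr 3) 1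
  have hL := h (Fin 2) (Fin 4) (Fin 2) rel mono rk head Set.univ a a'
  have ha : ∀ i, a i = (Finsupp.single (Sum.inr (0 : Fin 4)) 1 : Fin 2 ⊕ Fin 4 →₀ ℕ) i +
      (Finsupp.single (Sum.inr (2 : Fin 4)) 1 : Fin 2 ⊕ Fin 4 →₀ ℕ) i := fun i => Finsupp.add_apply _ _ _
  have ha' : ∀ i, a' i = (Finsupp.single (Sum.inr (1 : Fin 4)) 1 : Fin 2 ⊕ Fin 4 →₀ ℕ) i +
      (Finsupp.single (Sum.inr (3 : Fin 4)) 1 : Fin 2 ⊕ Fin 4 →₀ ℕ) i := fun i => Finsupp.add_apply _ _ _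
  -- (1) nonzero
  have hne : (monomial a (1 : ℤ) - monomial a' 1 : ModelRing (Fin 2) (Fin 4) ℤ) ≠ 0 := by
    intro h0
    have h1 := congr_arg (coeff a) (sub_eq_zero.mp h0)
    have haa : a' ≠ a := by
      intro e; have := DFunLike.congr_fun e (Sum.inr 0); rw [ha, ha'] at this; simp at this
    rw [coeff_monomial, coeff_monomial, if_pos rfl, if_neg haa] at h1
    exact one_ne_zero h1
  -- (2) in ker^{mh}
  have hmono : ∀ u : Fin 4, mono u = if u.val < 2 then Finsupp.single 0 1 else Finsupp.single 1 1 := fun u => rfl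
  have hm : (monomial a (1 : ℤ) : ModelRing (Fin 2) (Fin 4) ℤ) =
      rhoVar (k := ℤ) (σ := Fin 2) (0 : Fin 4) * rhoVar (k := ℤ) (σ := Fin 2) (2 : Fin 4) := by
    unfold rhoVar; rw [X, X, monomial_mul, one_mul]
  have hm' : (monomial a' (1 : ℤ) : ModelRing (Fin 2) (Fin 4) ℤ) =
      rhoVar (k := ℤ) (σ := Fin 2) (1 : Fin 4) * rhoVar (k := ℤ) (σ := Fin 2) (3 : Fin 4) := by
    unfold rhoVar; rw [X, X, monomial_mul, one_mul]
  have hφm : varphi (k := ℤ) mono (monomial a (1 : ℤ) : ModelRing (Fin 2) (Fin 4) ℤ) =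
      monomial (Finsupp.single 0 1 + Finsupp.single 1 1) 1 := by
    rw [hm, map_mul, varphi_rhoVar, varphi_rhoVar]
    unfold img
    rw [hmono 0, hmono 2, if_pos (by decide), if_neg (by decide), monomial_mul, one_mul]
  have hφ : varphi (k := ℤ) mono (monomial a (1 : ℤ) - monomial a' 1 : ModelRing (Fin 2) (Fin 4) ℤ) = 0 := by
    rw [map_sub, hm, hm', map_mul, map_mul, varphi_rhoVar, varphi_rhoVar, varphi_rhoVar, varphi_rhoVar, sub_eq_zero]
    unfold img
    rw [hmono 0, hmono 1, hmono 2, hmono 3]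
    simp
  have hw : ∀ G : Fin 2, Finsupp.weight (blockWeight rel G) a = Finsupp.weight (blockWeight rel G) a' := by
    intro G
    simp only [a, a', map_add, Finsupp.weight_single, blockWeight, rel]
    fin_cases G <;> simp
  have hmem : (monomial a (1 : ℤ) - monomial a' 1 : ModelRing (Fin 2) (Fin 4) ℤ) ∈
      kerMH (k := ℤ) rel mono Set.univ := by
    refine ⟨?_, ?_, hφ⟩
    · rw [RSub_univ]; exact Algebra.mem_top
    · intro G
      refine ⟨Finsupp.weight (blockWeight rel G) a, ?_⟩
      rw [← mem_weightedHomogeneousSubmodule]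
      apply Submodule.sub_mem <;> rw [mem_weightedHomogeneousSubmodule] <;>
        apply isWeightedHomogeneous_monomial
      · rfl
      · exact (hw G).symm
  -- (3) no common factor
  have hncf : HasNoCommonFactor (σ := Fin 2) (T := Fin 4) a a' := by
    intro i
    rw [ha, ha']
    rcases i with i | j
    · left; simp
    · fin_cases j <;> simp
  -- (4) ℘-irreducible
  have hmonoR : ∀ u : Fin 4, ∀ j : Fin 4, monoR mono u (Sum.inr j : Fin 2 ⊕ Fin 4) = 0 :=
    fun u j => Finsupp.mapDomain_notin_range _ _ (by rintro ⟨s, hs⟩; cases hs)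
  have hmonoRy : ∀ u : Fin 4, u.val < 2 → monoR mono u (Sum.inl (0 : Fin 2) : Fin 2 ⊕ Fin 4) = 1 := by
    intro u hu; unfold monoR; rw [hmono u, if_pos hu, Finsupp.mapDomain_single]; simp
  have hmonoRz : ∀ u : Fin 4, ¬ u.val < 2 → monoR mono u (Sum.inl (1 : Fin 2) : Fin 2 ⊕ Fin 4) = 1 := by
    intro u hu; unfold monoR; rw [hmono u, if_neg hu, Finsupp.mapDomain_single]; simp
  have hrel' : ∀ u : Fin 4, rel u = if u.val < 2 then 0 else 1 := fun u => rfl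
  have hA : ∀ j : Fin 4, a (Sum.inr j) ≠ 0 → j = 0 ∨ j = 2 := by
    intro j; rw [ha]; fin_cases j <;> simp
  have hA' : ∀ j : Fin 4, a' (Sum.inr j) ≠ 0 → j = 1 ∨ j = 3 := by
    intro j; rw [ha']; fin_cases j <;> simp
  have haL : ∀ i : Fin 2, a (Sum.inl i) = 0 := by intro i; rw [ha]; simp
  have ha'L : ∀ i : Fin 2, a' (Sum.inl i) = 0 := by intro i; rw [ha']; simp
  have hirr : IsWpIrreducible (k := ℤ) rel mono Set.univ a a' := by
    rintro ⟨t1, t1', hrel, hne', -, -, hcases⟩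
    rcases hcases with ⟨h1, h2⟩ | ⟨h1, h2⟩
    · have e1 := Finsupp.le_def.mp h1 (Sum.inr t1)
      rw [Finsupp.add_apply, hmonoR, zero_add, Finsupp.single_eq_same] at e1
      have e2 := Finsupp.le_def.mp h2 (Sum.inr t1')
      rw [Finsupp.single_eq_same] at e2
      rcases hA t1 (by omega) with rfl | rfl <;> rcases hA' t1' (by omega) with rfl | rfl
      · have e3 := Finsupp.le_def.mp h1 (Sum.inl 0)
        rw [Finsupp.add_apply, hmonoRy 1 (by decide), haL] at e3; simp at e3
      · rw [hrel', hrel'] at hrel; exact absurd hrel (by decide)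
      · rw [hrel', hrel'] at hrel; exact absurd hrel (by decide)
      · have e3 := Finsupp.le_def.mp h1 (Sum.inl 1)
        rw [Finsupp.add_apply, hmonoRz 3 (by decide), haL] at e3; simp at e3
    · have e1 := Finsupp.le_def.mp h1 (Sum.inr t1)
      rw [Finsupp.single_eq_same] at e1
      have e2 := Finsupp.le_def.mp h2 (Sum.inr t1')
      rw [Finsupp.add_apply, hmonoR, zero_add, Finsupp.single_eq_same] at e2
      rcases hA t1 (by omega) with rfl | rfl <;> rcases hA' t1' (by omega) with rfl | rfl
      · have e3 := Finsupp.le_def.mp h2 (Sum.inl 0)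
        rw [Finsupp.add_apply, hmonoRy 0 (by decide), ha'L] at e3; simp at e3
      · rw [hrel', hrel'] at hrel; exact absurd hrel (by decide)
      · rw [hrel', hrel'] at hrel; exact absurd hrel (by decide)
      · have e3 := Finsupp.le_def.mp h2 (Sum.inl 1)
        rw [Finsupp.add_apply, hmonoRz 2 (by decide), ha'L] at e3; simp at e3
  -- (5) yet the «rank-1 variable» `y = x̄_(head 0)` divides `φ(m) = y z`
  obtain ⟨hdiv, -⟩ := hL hne hmem hncf hirr
  apply hdiv 0 rfl
  have hhead : head 0 = 0 := rfl
  rw [hhead, hφm]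
  unfold img
  rw [hmono 0, if_pos (by decide)]
  exact ⟨monomial (Finsupp.single 1 1) 1, by rw [monomial_mul, one_mul]⟩

end Literature.AlgebraicGeometry.Hu2025.Statements.S04ModelV

end
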